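import Literature.NumberTheory.EllipticCurves.TianYuanZhang2017.CMPointGaloisDisplays
import Literature.NumberTheory.QuadraticFields.RingClassGroup
import HarnessLib

/-!
# Tian–Yuan–Zhang 2017 Prop. 3.2 (1)(2) with class field theory (Cox §9.A), AS PRINTED: the ring class dictionary
# `Gal(H′_d/K_d) ≅ Pic(𝒪₂)` (`d ≡ 5 (mod 8)`) / `≅ Pic(𝒪₄)` (`d ≡ 6 (mod 8)`) on the CM-point layer of the genus-point
# data — DISPLAYS (nothing asserted)

Companion to `GenusPointDescentDisplays.lean` (`structure GenusPointData n`, `Printed`, `tyz_genusPointData`) and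
`CMPointGaloisDisplays.lean` (`CMPointGaloisPrinted`: the CM points `z_d`, the groups `Gal(ℍ′_n/H_d) ⊇ Gal(ℍ′_n/H′_d)`, the
order-two `σ` with `z_d^σ = z_d + τ(1)`, the representatives `Φ₀`, complex conjugation; `tyz_cmPointGaloisData`).  Those two
files display the genus-point descent of [TianYuanZhang2017] §3 on ABSTRACT subgroups of `Gal(ℍ′_n/ℚ) = (D.H ≃ₐ[ℚ] D.H)`; they
deliberately do not identify the group `Gal(H′_d/K_d)` (`= Cl′_d` for `d ≡ 5 (mod 8)`, p0011 L1–L13) with a class group.  THIS file displays exactly that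
identification — the class-field-theoretic content of Prop. 3.2 (1)(2) (p0010 L106–L113) — in the tree's own currency
`Literature.NumberTheory.QuadraticFields.RingClass.RingClassGroup K f = I_K(f)/P_{K,ℤ}(f)` (Cox §7.C, `≅ Pic(𝒪_f)` by Cox Prop. 7.22)
for `K = K_d = GenusField d`, so that «a Galois element of `Gal(H′_d/L_d(i))` with `g^{g(d)} = σ`» (the MOVER of the genus period of
the cell's note `Cruxes/RamifiedOffTYZOfFacts/Lines/offtyz_v7_TransferLayer.md`, §3 (B2), §8, §10 (b)) becomes a statement about the
finite abelian group `Pic(𝒪₂)` of `ℚ(√−d)` and its order-two subgroup `ker(Pic(𝒪₂) → Cl(𝒪_K))`, decidable per family by the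
tree's genus / Rédei–Reichardt theory (`QuadraticFields/Redei*`, `GenusCharacters`, `RingClassGroupTower*`).  HONEST FRAMING: a display
(one predicate per printed sentence, read on named objects) and ONE named fact refining `tyz_cmPointGaloisData`; nothing is asserted
(no `_holds`), no count moves; consumers take `(h : tyz_cmPointRingClassData)` as an explicit hypothesis.  Cell `bsd-print-cf2`, seat
`bsd-print-cf2-ty2` (typer), answering the LEAD's ask (cruxlead-20509 g4, HOME/STATUS 2026-08-28T22:16:47Z; note §8).  BSD is not proved
by any of this; no class is closed by this file.

## THE PRINT (chunks of the materialised arXiv text `paper:arxiv-1411.4728`; J = journal page, AJM 21 (2017))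

* p0010 L97–L104: "denote by `σ : K_n^× \ K̂_n^× → Gal(K_n^{ab}/K_n)` the geometric Artin map, normalized by sending the
  uniformizers to the geometric Frobenii.  So it is the reciprocal of the usual Artin map."
* **Prop. 3.2 (1)** (p0010 L108–L109), `n ≡ 5 (mod 8)`: "`Gal(H′_n/H_n) ≃ ℤ/2ℤ` is generated by `σ_ϖ²`.  Here `ϖ = (√−n − 1)_2 ∈
  K_{n,2}^×`.  The field `H′_n(√2)` is the ring class field of conductor `4` over `K_n`.  The Galois group `Gal(H′_n(√2)/H_n) ≃ (ℤ/2ℤ)²`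
  is generated by `σ_{1+2ϖ}` and `σ_ϖ²`, and `H′_n` is the subfield of `H′_n(√2)` fixed by `σ_{1+2ϖ}`."
* **Prop. 3.2 (2)** (p0010 L111), `n ≡ 6 (mod 8)`: "`Gal(H′_n/H_n) ≃ ℤ/4ℤ` is generated by `σ_{1+ϖ}`.  Here `ϖ = (√−n)_2 ∈ K_{n,2}^×`.
  The subfield of `H′_n` fixed by `σ_{1+ϖ}²` is `H_n(i)`.  The field `H′_n` is exactly the ring class field of conductor `4` over `K_n`."
* p0011 L1–L13 (J738): "Denote `K′_n = K_n, K_n(i), K_n` according to `n ≡ 5, 6, 7 (mod 8)` respectively.  Set `Cl_n = Gal(H_n/K_n)`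
  and `Cl′_n = Gal(H′_n/K′_n)`.  Let `σ` be the unique order-two element of `Gal(H′_n/H_n)` … the natural map `Cl′_n → Cl_n` induces two
  isomorphisms `Cl′_n/⟨σ⟩ ≅ Cl_n`, `(2Cl′_n)/⟨σ⟩ ≅ 2Cl_n` … Note that `σ_{1+ϖ} ∉ Cl′_n`"; proof of Lemma 3.21 (J759 = p0020 L55–L58): "the
  subfield of `H′_n` fixed by `2Cl′_n` is `L_n, L_n(i), L_n` according to `n ≡ 5, 6, 7 (mod 8)`.  The field `L_n(i) = ℚ(i, √d : d ∣ n)`."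
* Class field theory behind the words "ring class field of conductor `f`" (Cox, *Primes of the form x² + ny²*, 2nd ed. [Cox2013]):
  §9.A pp. 180–181 "the Artin map … induce[s] `C(𝒪) ≃ I_K(f)/P_{K,ℤ}(f) ≃ Gal(L/K)`" (tree: `NumberFields/RingClassFieldArtinMap`,
  `RingClassField.exists_artinEquiv`; uniqueness of the ring class field from its splitting law, `RingClassFieldOfConductor`); §7.D
  (7.25)–(7.27) (the exact sequence `1 → (ℤ/f)^× → (𝒪_K/f)^× → ker(C(𝒪_f) → C(𝒪_K)) → 1` for `𝒪_K^× = {±1}`; tree: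
  `RingClassNumber.range_theta_eq_ker`, `RingClassGroupTowerKernel`); Thm. 7.24 (`h(𝒪_f) = h(𝒪_K)·f·∏_{p∣f}(1 − (d_K/p)p⁻¹)/[𝒪_K^× : 𝒪_f^×]`;
  tree: `RingClassNumber.card_ringClassGroup_mul`).  The restriction `Gal(H_{d,f}/K_d) → Gal(H_{d,f′}/K_d)` (`f′ ∣ f`) is the change of
  conductor `C(𝒪_f) → C(𝒪_{f′})` (functoriality of the Artin map; tree `RingClass.restrict`, `toClassGroup`).

## WHAT IS DISPLAYED, AND WHY IT IS A FAITHFUL READING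

For a block `d ∣ n`, `d ≡ 5, 6 (mod 8)`, of `D : GenusPointData n`, with the objects `ΓH d = Gal(ℍ′_n/H_d) ⊇ ΓH' d = Gal(ℍ′_n/H′_d)` and
`σ d` of `CMPointGaloisPrinted` (so `Gal(H′_d/K_d) = Gal(ℍ′_n/K_d)/Gal(ℍ′_n/H′_d)`, where `Gal(ℍ′_n/K_d)` is the stabiliser `galK D d` of
`√−d`; `ΓH' d` is normal in `Gal(ℍ′_n/ℚ)` by (G3)), the new object is a group homomorphism
  `ρ_d : Gal(ℍ′_n/K_d) → I_K(f)/P_{K,ℤ}(f)`, `K = GenusField d = ℚ[X]/(X² + d) ≅ K_d`, `f = 2` (`d ≡ 5`) resp. `f = 4` (`d ≡ 6`),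
and the displayed sentences are:
* (RC1) `ρ_d` is ONTO with kernel `Gal(ℍ′_n/H′_d)` — i.e. `Gal(H′_d/K_d) ≅ Pic(𝒪_f)`.  For `d ≡ 6 (mod 8)` this is Prop. 3.2 (2) "`H′_n` is
  exactly the ring class field of conductor `4`" + Cox §9.A.  For `d ≡ 5 (mod 8)` Prop. 3.2 (1) prints `H′_n ⊂ H′_n(√2) = H_{n,4}` with
  `H′_n = H_{n,4}^{σ_{1+2ϖ}}`; by Cox §9.A `Gal(H_{n,4}/K_n) ≅ Pic(𝒪₄)`, and `σ_{1+2ϖ}|_{H_{n,4}}` is the class of a principal ideal `(a)`,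
  `a ≡ (1+2ϖ)^{±1} ≡ −1 + 2√−n (mod 4)` (the idèle `1 + 2ϖ` is a unit at `2`; either normalisation of the Artin map, since this class has
  order `2`), which lies in `ker(Pic(𝒪₄) → Pic(𝒪₂))` (`−1 + 2√−n ≡ −1 ∈ ℤ (mod 2)`) and is `≠ 1` (it is one of the two printed generators
  of `Gal(H_{n,4}/H_n) ≅ (ℤ/2)²`); as `#ker(Pic(𝒪₄) → Pic(𝒪₂)) = h(𝒪₄)/h(𝒪₂) = 4h/2h = 2` (Thm. 7.24, `2` ramified, `𝒪_K^× = {±1}`), the fixed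
  field of `σ_{1+2ϖ}` is `H_{n,2}`: **`H′_n = H_{n,2}`, the ring class field of conductor `2`, and `Gal(H′_n/K_n) ≅ Pic(𝒪₂)`** (the remark of
  the cell note `offtyz_v7_TransferLayer.md` §1).  So (RC1) at conductor `2` is Prop. 3.2 (1) read through Cox §9.A / Thm. 7.24.
* (RC2) `ρ_d(g) ∈ ker(Pic(𝒪_f) → Cl(𝒪_K)) ⟺ g ∈ Gal(ℍ′_n/H_d)` — "`H_n` the Hilbert class field", `Gal(H_n/K_n) = Cl_n`, and the restriction
  `Gal(H′_n/K_n) → Gal(H_n/K_n)` is the change of conductor (Cox §9.A functoriality; `toClassGroup`).  Consequently `ρ_d(σ d)` is THE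
  non-trivial element of that kernel for `d ≡ 5` (order `2` = `[H′_n : H_n]`, Prop. 3.2 (1)), and `ρ_d(θ d)` generates it (`≅ ℤ/4`) for
  `d ≡ 6` — derivable from (G6)/(G8) of `CMPointGaloisPrinted` and (RC1)–(RC2), not displayed separately.
* (RC3) `g` is trivial on `L_d(i)` ⟺ `ρ_d(g)` is a SQUARE of `ρ_d(Gal(ℍ′_n/K′_d))` — "`Cl′_n := Gal(H′_n/K′_n)`, `K′_n = K_n, K_n(i), K_n`
  according to `n ≡ 5, 6, 7 (mod 8)`" (p0011 L1–L2) and "the subfield of `H′_n` fixed by `2Cl′_n` is `L_n, L_n(i), L_n`" (J759): for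
  `d ≡ 5` simply `IsSquare (ρ_d g)` in `Pic(𝒪₂)` (`K′_d = K_d`, `ρ_d` onto); for `d ≡ 6` "`ρ_d(g) = ρ_d(h)²` for some `h` fixing `√−d` and `i`"
  (`K′_d = K_d(i)`; "`σ_{1+ϖ} ∉ Cl′_n`", p0011 L9, so the squares of `Gal(H′_d/K_d)` would be too many).
NORMALISATION.  The display records the Artin isomorphism only through content that is invariant under composing `ρ_d` with an
automorphism of `Pic(𝒪_f)` preserving `ker(→ Cl)` and squares — in particular under inversion (geometric vs. arithmetic normalisation,
p0010 L97–L104): it does NOT display `ρ_d(Frob_v) = [𝔭_v]^{±1}`.  Every use foreseen by the cell (the mover criterion «`∃ g` trivial on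
`L_d(i)` with `g^{g(d)} ≡ σ`» ⟺ «`∃ x ∈ Pic(𝒪₂)², x^{g(d)} = κ`», `κ` the non-trivial element of `ker(Pic(𝒪₂) → Cl)`, `g(d) = gK d = #Cl²`)
is of this invariant kind.  A Frobenius-level display can be appended later without touching these conjuncts.
NOT displayed: the elements `σ_ϖ`, `σ_{1+2ϖ}`, `σ_{1+ϖ}` as idèlic Artin symbols; `H′_n(√2)` and the point `w` with `(1 − i)w = z_n` (they
live in `H_{n,4} ⊄ ℍ′_n` for odd `n`: `√2 ∉ ℍ′_n`, Lemma 3.18); Prop. 3.2 (3)(4); any class-number VALUE.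

References: [TianYuanZhang2017] Prop. 3.2 (p0010 L106–L113), §3.1 (p0011 L1–L13), proof of Lemma 3.21 (p0020 L55–L58); [Cox2013] §7.C
(p. 145: `I_K(f)`, `P_{K,ℤ}(f)`), Prop. 7.22, §7.D Thm. 7.24 and (7.25)–(7.27) (pp. 146–147), §9.A (pp. 180–181); the cell note
`Summits/…/Cruxes/RamifiedOffTYZOfFacts/Lines/offtyz_v7_TransferLayer.md` §1, §3 (B2), §4, §8, §10 (b) (cruxlead-20509 g4).
-/

noncomputable section

open scoped Classical

open WeierstrassCurve Finset

namespace Literature.NumberTheory.EllipticCurves.TianYuanZhang2017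

open Literature.NumberTheory.QuadraticFields.RingClass

namespace GenusPointData

variable {n : ℕ}

/-! ## §1 `Gal(ℍ′_n/K_d)`: the automorphisms fixing `√−d` -/

/-- **`Gal(ℍ′_n/K_d)`** as the stabiliser of `√−d` in `Gal(ℍ′_n/ℚ) = Aut_ℚ(ℍ′_n)` (`K_d = ℚ(√−d) ⊂ ℍ′_n` for `d ∣ n`, p0011 L60–L64).
[cite: TianYuanZhang2017, §3.1 (p0011 L1–L13: Cl′_n := Gal(H′_n/K_n)) and (p0011 L60–L64)] -/
def galK (D : GenusPointData n) (d : ℕ) : Subgroup (D.H ≃ₐ[ℚ] D.H) :=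
  MulAction.stabilizer (D.H ≃ₐ[ℚ] D.H) (D.sqrtNeg d)

/-- `g ∈ Gal(ℍ′_n/K_d)` iff `g(√−d) = √−d`. [cite: TianYuanZhang2017, §3.1 (p0011 L1–L13)] -/
theorem mem_galK_iff (D : GenusPointData n) (d : ℕ) (g : D.H ≃ₐ[ℚ] D.H) :
    g ∈ D.galK d ↔ g (D.sqrtNeg d) = D.sqrtNeg d :=
  Iff.rfl

/-! ## §2 The printed sentences: the ring class dictionary of a block -/

/-- **The ring class dictionary of a block `d ≡ 5 (mod 8)`** (conjuncts (RC1)–(RC3) of the module docstring): `ρ` maps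
`Gal(ℍ′_n/K_d)` ONTO `Pic(𝒪₂) = I_K(2)/P_{K,ℤ}(2)` of `K = K_d` with kernel `Gal(ℍ′_n/H′_d)` (Prop. 3.2 (1) + Cox §9.A / Thm. 7.24:
`H′_d = H_{d,2}`, `Gal(H′_d/K_d) ≅ Pic(𝒪₂)`); `ρ(g) ∈ ker(Pic(𝒪₂) → Cl(𝒪_K)) ⟺ g ∈ Gal(ℍ′_n/H_d)` (restriction to the Hilbert class field
= change of conductor); `g` trivial on `L_d(i)` ⟺ `ρ(g)` is a square ("the subfield of `H′_n` fixed by `2Cl′_n` is `L_n`", J759).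
A predicate; nothing asserted.
[cite: TianYuanZhang2017, Prop. 3.2 (1) (p0010 L108–L109); §3.1 (p0011 L1–L13); proof of Lemma 3.21 (p0020 L55–L58)]
[cite: Cox2013, §9.A (pp. 180–181), §7.D Thm. 7.24 and (7.25)–(7.27), Prop. 7.22] -/
def RingClassTwoBlockSpec (D : GenusPointData n) (d : ℕ) (ΓH ΓH' : Subgroup (D.H ≃ₐ[ℚ] D.H))
    (ρ : D.galK d →* RingClassGroup (GenusField d) 2) : Prop :=
  -- (RC1) `Gal(H′_d/K_d) ≅ Pic(𝒪₂)`: onto, kernel `Gal(ℍ′_n/H′_d)`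
  Function.Surjective ρ ∧ (∀ g : D.galK d, ρ g = 1 ↔ (g : D.H ≃ₐ[ℚ] D.H) ∈ ΓH') ∧
  -- (RC2) `Gal(H′_d/H_d) ↔ ker(Pic(𝒪₂) → Cl(𝒪_K))`
  (∀ g : D.galK d, toClassGroup (GenusField d) 2 (ρ g) = 1 ↔ (g : D.H ≃ₐ[ℚ] D.H) ∈ ΓH) ∧
  -- (RC3) "the subfield of `H′_n` fixed by `2Cl′_n` is `L_n` (= `L_n(i)`)"
  (∀ g : D.galK d, D.TrivialOnL d g ↔ IsSquare (ρ g))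

/-- **The ring class dictionary of a block `d ≡ 6 (mod 8)`** (conjuncts (RC1)–(RC3), conductor `4`): `ρ` maps `Gal(ℍ′_n/K_d)` ONTO
`Pic(𝒪₄) = I_K(4)/P_{K,ℤ}(4)` of `K = K_d` with kernel `Gal(ℍ′_n/H′_d)` (Prop. 3.2 (2) "`H′_n` is exactly the ring class field of conductor
`4` over `K_n`" + Cox §9.A); `ρ(g) ∈ ker(Pic(𝒪₄) → Cl(𝒪_K)) ⟺ g ∈ Gal(ℍ′_n/H_d)`; `g` trivial on `L_d(i)` ⟺ `ρ(g) = ρ(h)²` for some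
`h` fixing `√−d` and `i` ("`Cl′_n := Gal(H′_n/K′_n)`, `K′_n = K_n(i)` for `n ≡ 6 (mod 8)`", p0011 L1–L2; "the subfield of `H′_n` fixed by
`2Cl′_n` is `L_n(i)`", J759 — NB for `n ≡ 6` the squares are those of `Gal(H′_n/K_n(i))`, an index-`2` subgroup of `Gal(H′_n/K_n)`:
"`σ_{1+ϖ} ∉ Cl′_n`", p0011 L9).  A predicate; nothing asserted.
[cite: TianYuanZhang2017, Prop. 3.2 (2) (p0010 L111); §3.1 (p0011 L1–L13); proof of Lemma 3.21 (p0020 L55–L58)]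
[cite: Cox2013, §9.A (pp. 180–181), §7.D (7.25)–(7.27), Prop. 7.22] -/
def RingClassFourBlockSpec (D : GenusPointData n) (d : ℕ) (ΓH ΓH' : Subgroup (D.H ≃ₐ[ℚ] D.H))
    (ρ : D.galK d →* RingClassGroup (GenusField d) 4) : Prop :=
  -- (RC1) `Gal(H′_d/K_d) ≅ Pic(𝒪₄)`: onto, kernel `Gal(ℍ′_n/H′_d)`
  Function.Surjective ρ ∧ (∀ g : D.galK d, ρ g = 1 ↔ (g : D.H ≃ₐ[ℚ] D.H) ∈ ΓH') ∧
  -- (RC2) `Gal(H′_d/H_d) ↔ ker(Pic(𝒪₄) → Cl(𝒪_K))`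
  (∀ g : D.galK d, toClassGroup (GenusField d) 4 (ρ g) = 1 ↔ (g : D.H ≃ₐ[ℚ] D.H) ∈ ΓH) ∧
  -- (RC3) "`Cl′_n = Gal(H′_n/K′_n)`, `K′_n = K_n(i)`"; "the subfield of `H′_n` fixed by `2Cl′_n` is `L_n(i)`":
  --        `g` is trivial on `L_d(i)` iff `g ≡ h²` modulo `Gal(ℍ′_n/H′_d)` for some `h` fixing `√−d` AND `i`
  (∀ g : D.galK d, D.TrivialOnL d g ↔ ∃ h : D.galK d, (h : D.H ≃ₐ[ℚ] D.H) D.im = D.im ∧ ρ g = ρ h * ρ h)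

/-- **Tian–Yuan–Zhang §3.1–3.2 / Prop. 3.2 / Thm. 3.6 / p. 759 on the data `D`, all blocks, WITH the ring class dictionary**: the
objects and sentences of `CMPointGaloisPrinted` (CM points `z_d`, representative sets `Φ₀^{(d)}`, `Gal(ℍ′_n/H_d) ⊇ Gal(ℍ′_n/H′_d)`, `σ^{(d)}`,
`θ^{(d)}`, complex conjugation `c`) AND, for every block `d ≡ 5 (mod 8)`, a ring class dictionary of conductor `2`
(`RingClassTwoBlockSpec`) and, for every block `d ≡ 6 (mod 8)`, one of conductor `4` (`RingClassFourBlockSpec`), on the SAME subgroups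
`Gal(ℍ′_n/H_d)`, `Gal(ℍ′_n/H′_d)`.  (Values of the object-functions at non-blocks are unconstrained.)  A predicate; nothing asserted.
[cite: TianYuanZhang2017, §3.1 (J738–J739), Prop. 3.2 (1)(2)(3) (p0010 L106–L113), Thm. 3.6 (1)(2) (J741), proof of Lemma 3.15 (J750), proof of Lemma 3.21 (J759), §2.1 (J725)]
[cite: Cox2013, Thm. 6.1, Lemma 9.3, §9.A (pp. 180–181), §7.D Thm. 7.24 and (7.25)–(7.27)] -/
def CMPointRingClassPrinted (D : GenusPointData n) : Prop :=
  ∃ (z : ℕ → APoint D.H) (Φ : ℕ → Finset (D.H ≃ₐ[ℚ] D.H)) (ΓH ΓH' : ℕ → Subgroup (D.H ≃ₐ[ℚ] D.H))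
    (σ θ : ℕ → (D.H ≃ₐ[ℚ] D.H)) (c : D.H ≃ₐ[ℚ] D.H)
    (ρ₂ : (d : ℕ) → (D.galK d →* RingClassGroup (GenusField d) 2))
    (ρ₄ : (d : ℕ) → (D.galK d →* RingClassGroup (GenusField d) 4)),
    D.ConjSpec c ∧
    ∀ d ∈ n.divisors,
      ((d % 8 = 5 ∨ d % 8 = 6) → D.CMBlockSpec d (z d) (Φ d) (ΓH d) (ΓH' d) (σ d) c) ∧
      (d % 8 = 6 → D.ThetaBlockSpec d (z d) (ΓH d) (ΓH' d) (σ d) (θ d)) ∧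
      (d % 8 = 7 → D.SevenBlockSpec d) ∧
      (d % 8 = 5 → D.RingClassTwoBlockSpec d (ΓH d) (ΓH' d) (ρ₂ d)) ∧
      (d % 8 = 6 → D.RingClassFourBlockSpec d (ΓH d) (ΓH' d) (ρ₄ d))

end GenusPointData

/-! ## §3 The ONE named fact (its relation to `tyz_cmPointGaloisData` / `tyz_genusPointData` is proved in the sibling `…Proofs` file) -/

/-- **Tian–Yuan–Zhang 2017, §3 with the CM-point layer (§3.1–3.2, Thm. 3.6 (1)(2), p. 759) AND the ring class dictionary of
Prop. 3.2 (1)(2) read through class field theory (Cox §9.A), AS PRINTED, as ONE named fact**: for every positive square-free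
`n ≡ 5, 6, 7 (mod 8)` there are data `D : GenusPointData n` (the field `ℍ′_n ∋ i, √−d`, `β′`, genus points `Z(d₀)`, points `P(d)`,
signs) satisfying `GenusPointData.Printed` (Prop. 3.4, Thm. 3.5, Lemma 3.18, Lemma 3.21, the Galois facts on `β′`) and
`GenusPointData.CMPointRingClassPrinted` (for every block: the CM point `z_d` with `Z(d) = Σ_{t∈Φ₀} z_d^t`, `Gal(ℍ′_n/H_d) ⊇ Gal(ℍ′_n/H′_d)`,
the order-two `σ` with `z_d^σ = z_d + τ(1)`, `Φ₀` representing `2Cl′_d/⟨σ⟩`, complex conjugation, for `d ≡ 6` the lift of `σ_{1+ϖ}`,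
for `d ≡ 7` `Z(d) ∈ A(L_d)`; and the dictionaries `Gal(H′_d/K_d) ≅ Pic(𝒪₂)` (`d ≡ 5 (mod 8)`: `H′_d = H_{d,2}` by Prop. 3.2 (1) with
Cox §9.A / Thm. 7.24) resp. `≅ Pic(𝒪₄)` (`d ≡ 6 (mod 8)`: Prop. 3.2 (2)), each matching `Gal(H′_d/H_d)` with `ker(Pic → Cl(𝒪_{K_d}))` and
`Gal(H′_d/L_d(i))` with the squares).  Constructed in the source from the CM points on `X_U → A` (§3.1–3.2), Yuan–Zhang–Zhang's
Gross–Zagier formula (Thm. 3.3) and class field theory; no `_holds` expected.  Implies `tyz_cmPointGaloisData` and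
`tyz_genusPointData`.  Consumers take it as an explicit hypothesis; nothing is asserted here.
[cite: TianYuanZhang2017, §3: §3.1 (J738–J739), Prop. 3.2 (1)(2)(3) (p0010 L106–L113), Prop. 3.4, Thm. 3.5, Thm. 3.6 (J741), Lemma 3.18, Lemma 3.21 and its proof (J759 = p0020 L50–L63), proof of Lemma 3.15 (J750), §2.1 (J725)]
[cite: Cox2013, §9.A (pp. 180–181), §7.D Thm. 7.24 and (7.25)–(7.27), Prop. 7.22, Thm. 6.1, Lemma 9.3] -/
def tyz_cmPointRingClassData : Prop :=
  ∀ (n : ℕ), Squarefree n → (n % 8 = 5 ∨ n % 8 = 6 ∨ n % 8 = 7) →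
    ∃ D : GenusPointData n, D.Printed ∧ D.CMPointRingClassPrinted

end Literature.NumberTheory.EllipticCurves.TianYuanZhang2017

end
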